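import Summits.Ventures.Crystal3D.Theorems.StickyWulffConstantGenericWallFloorGeneralRung
import Summits.Ventures.Crystal3D.Theorems.StickyWulffConstantGenericWallFloorExitCertified
import Summits.Ventures.Crystal3D.Theorems.StickyWulffConstantCoaxialWallLawExitCountBelow
import HarnessLib

/-!
# N-TC: the CHAIN LEDGER — the general-filling wall floor at FULL charge `½(κ₁ + κ₂) ≥ 1`,
# modulo ONE `ExactOnly` row (C12-55), the twin-capped lattice exits, and the coincidence double tops

HONEST FRAMING. Part of the venture `Summits/Ventures/Crystal3D` (cell `crystal3d-full`), helper
`--supports` the crux `GenericWallFloor` (stmt-Ventures-19480) of `route-Ventures-StickyWulffConstant`,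
registered line `WallLedgerG`, open stub `stub_twoSlabAdhesion` (THE CRUX: general fillings).  Planner
cf-p1 ROUTE.md §81(3)/(7), typed target N-TC `twoSlabAdhesion_chainLedger`.  Rung credit only; F-C1 not
moved.

**Theorem (`twoSlabAdhesion_chainLedger`).**  Input BY NAME: the E1 row C12-55 = P₅ = closed vertex star,
`ExactOnly 0 {w ∈ fccSlots | 0 < ⟪w, s₀⟫}` for one slot `s₀` (inside-tube half kernel-certified:
`cert_C12_55_valid` + `ConeCert.eq_slots`; outside-tube = R39c).  For every pair of moved fcc lattices whose
slot sets differ (`¬ ∀ w, A₁ w ∈ A₂·Λ₀`, `¬ ∀ w, A₂ w ∈ A₁·Λ₀` — implied by non-co-axiality, 19480-p1's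
`…GeneralRungNotCoaxial`), every steep up-slot `u₁` of grain 1 and steep down-slot `u₂` of grain 2
(`⟪A₁ u₁, e₃⟫ ≥ √2/2`, `⟪A₂ u₂, e₃⟫ ≤ −√2/2`), with `κᵢ := √2 |⟪Aᵢ uᵢ, e₃⟫| ∈ [1, √2]` the line flux of the
slot class, there are `C` and `R₀ = 10` such that in EVERY cell of `TwoSlabAdhesion` (arbitrary
`1`-separated filling, clean outer slivers):

  `cross(P₁, X∖P₁) + cross(P₂, Y) ≤ D(Y) + (φ₁ + φ₂ − ½(κ₁ + κ₂)) π ρ² + ½ (#TC₁ + #TC₂ + #DT) + C (1 + h) ρ`,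

where `TCᵢ` = the TWIN-CAPPED LATTICE EXITS of grain `i` (exits `e ∈ Λᵢ` along `uᵢ` — full-shell
predecessor `e − Aᵢ uᵢ`, a missing slot — carrying an exact twin cap whose far triple contains `uᵢ`) and
`DT` = the DOUBLE TOPS: balls on BOTH lattices (`Λ₁ ∩ Λ₂`, coincidence sites) that are unsaturated exits of
BOTH grains (counted once by the payer ledger but claimed by both line families).  For the steepest slots
`κᵢ = √2·v₁₂(Aᵢ⁻¹e₃) ≥ 1` ((100) 1.000, (111) 1.155, (110) 1.414), so the main term is the crux's charge
`1·πρ²` or better; `#TCᵢ ≤ 12·#junk` for non-co-axial pairs (wulff-p2's `card_twinCapped_le_junk`); `DT = ∅`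
whenever `Λ₁ ∩ Λ₂ = ∅` (e.g. generic translates).  Compared with 19480-p1's
`general_twoSlabAdhesion_modulo_twinCaps` (charge `1/3770`, residual `#TC/7540`, inputs
`KissingGap`/`KissingClassification`): the credit sits AT the exit (`exit_unsaturated_or_twinCap`), so no
`÷1885` multiplicity and no averaging of the two grains — at the price of the honest double-top term.

Assembly: `Σ (12 − deg) ≥ 2(φ₁+φ₂)πρ² + #payers − c(1+h)ρ` (`ledger_ge_faces_add_payers`); unsaturated
lattice exits are payers (`y = e`), so `#payers ≥ #U₁ + #U₂ − #DT`; `#LEXᵢ ≤ #Uᵢ + #TCᵢ`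
(`exit_unsaturated_or_twinCap`); `#LEXᵢ ≥ κᵢ π(ρ−1)² − 10√2π(ρ−1)` (`card_lattice_exits_ge_window`,
19481-p2); the stub algebra of `rigid_twoSlabAdhesion` (`contactDeficiency_sdiff_split`,
`affineSampleDeficit_upper`, `two_mul_contactDeficiency_eq_sum`).

WHAT THIS IS NOT: not the stub (`ExactOnly` C12-55 is an input; the residuals `#TC` — junk cappers /
Barlow stacks, cf-p1 §81(3), 19480-p1's lines floor — and `#DT` — coincidence double tops, star lemma /
cf-p1 g24's double-star census — are not bounded here; clean slivers assumed); F-C1 not moved.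
-/

noncomputable section

namespace Summit.Ventures.Crystal3D.Theorems

open Summit.Ventures.Crystal3D Finset
open Literature.MathematicalPhysics.StatisticalMechanics (fccStacking contactDeficiency)
open scoped InnerProductSpace

open scoped Classical in
/-- **The chain ledger (N-TC).**  See the module docstring. -/
theorem twoSlabAdhesion_chainLedger
    {s₀ : EuclideanSpace ℝ (Fin 3)} (hs₀ : s₀ ∈ fccSlots)
    (hcert : ExactOnly 0 (fccSlots.filter fun w => 0 < ⟪w, s₀⟫_ℝ))
    (A₁ : EuclideanSpace ℝ (Fin 3) ≃ₗᵢ[ℝ] EuclideanSpace ℝ (Fin 3)) (t₁ : EuclideanSpace ℝ (Fin 3))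
    (A₂ : EuclideanSpace ℝ (Fin 3) ≃ₗᵢ[ℝ] EuclideanSpace ℝ (Fin 3)) (t₂ : EuclideanSpace ℝ (Fin 3))
    (hA₁₂ : ¬ ∀ w ∈ fccSlots, A₁ w ∈ A₂ '' fccStacking 1 (Real.sqrt (2 / 3)))
    (hA₂₁ : ¬ ∀ w ∈ fccSlots, A₂ w ∈ A₁ '' fccStacking 1 (Real.sqrt (2 / 3)))
    {u₁ : EuclideanSpace ℝ (Fin 3)} (hu₁ : u₁ ∈ fccSlots)
    (hsteep₁ : Real.sqrt 2 / 2 ≤ ⟪A₁ u₁, EuclideanSpace.single (2 : Fin 3) (1 : ℝ)⟫_ℝ)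
    {u₂ : EuclideanSpace ℝ (Fin 3)} (hu₂ : u₂ ∈ fccSlots)
    (hsteep₂ : ⟪A₂ u₂, EuclideanSpace.single (2 : Fin 3) (1 : ℝ)⟫_ℝ ≤ -(Real.sqrt 2 / 2)) :
    ∃ C R₀ : ℝ, 1 ≤ R₀ ∧ ∀ h : ℝ, 0 ≤ h → ∀ ρ : ℝ, R₀ ≤ ρ →
      ∀ X P₁ P₂ : Finset (EuclideanSpace ℝ (Fin 3)),
      (∀ p ∈ X, ∀ q ∈ X, p ≠ q → 1 ≤ dist p q) → P₁ ⊆ X → P₂ ⊆ X \ P₁ →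
      (∀ p ∈ X, -(2 * R₀) ≤ p 2 ∧ p 2 ≤ h + 2 * R₀ ∧ p 0 ^ 2 + p 1 ^ 2 ≤ ρ ^ 2) →
      (∀ p, p ∈ P₁ ↔ (p ∈ (fun q => A₁ q + t₁) '' fccStacking 1 (Real.sqrt (2 / 3)) ∧
        -(2 * R₀) ≤ p 2 ∧ p 2 ≤ -R₀ ∧ p 0 ^ 2 + p 1 ^ 2 ≤ ρ ^ 2)) →
      (∀ p, p ∈ P₂ ↔ (p ∈ (fun q => A₂ q + t₂) '' fccStacking 1 (Real.sqrt (2 / 3)) ∧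
        h + R₀ ≤ p 2 ∧ p 2 ≤ h + 2 * R₀ ∧ p 0 ^ 2 + p 1 ^ 2 ≤ ρ ^ 2)) →
      -- CLEAN outer slivers
      (∀ p ∈ X, p 2 < -(2 * R₀) + 1 → p ∈ (fun q => A₁ q + t₁) '' fccStacking 1 (Real.sqrt (2 / 3))) →
      (∀ p ∈ X, h + 2 * R₀ - 1 < p 2 → p ∈ (fun q => A₂ q + t₂) '' fccStacking 1 (Real.sqrt (2 / 3))) →
      ((((P₁ ×ˢ (X \ P₁)).filter fun pq => dist pq.1 pq.2 = 1).card : ℕ) : ℝ) +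
        ((((P₂ ×ˢ ((X \ P₁) \ P₂)).filter fun pq => dist pq.1 pq.2 = 1).card : ℕ) : ℝ) ≤
        contactDeficiency ((X \ P₁) \ P₂) +
          (Real.sqrt 2 / 4 * ∑ᶠ w ∈ {w ∈ fccStacking 1 (Real.sqrt (2 / 3)) | ‖w‖ = 1},
              |⟪w, A₁.symm (EuclideanSpace.single (2 : Fin 3) (1 : ℝ))⟫_ℝ| +
            Real.sqrt 2 / 4 * ∑ᶠ w ∈ {w ∈ fccStacking 1 (Real.sqrt (2 / 3)) | ‖w‖ = 1},
              |⟪w, A₂.symm (EuclideanSpace.single (2 : Fin 3) (1 : ℝ))⟫_ℝ| -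
            (Real.sqrt 2 * |⟪A₁ u₁, EuclideanSpace.single (2 : Fin 3) (1 : ℝ)⟫_ℝ| +
              Real.sqrt 2 * |⟪A₂ u₂, EuclideanSpace.single (2 : Fin 3) (1 : ℝ)⟫_ℝ|) / 2) * Real.pi * ρ ^ 2 +
          (((((X.filter fun e => e ∈ (fun q => A₁ q + t₁) '' fccStacking 1 (Real.sqrt (2 / 3)) ∧
                e - A₁ u₁ ∈ X ∧ (∀ w ∈ fccSlots, e - A₁ u₁ + A₁ w ∈ X) ∧
                ∃ v ∈ fccSlots, e + A₁ v ∉ X).filter fun e => ∃ n : EuclideanSpace ℝ (Fin 3), ‖n‖ = 1 ∧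
              (∀ w ∈ fccSlots, ⟪A₁ w, n⟫_ℝ = 0 ∨ ⟪A₁ w, n⟫_ℝ = Real.sqrt (2 / 3) ∨
                ⟪A₁ w, n⟫_ℝ = -Real.sqrt (2 / 3)) ∧
              ⟪A₁ u₁, n⟫_ℝ = Real.sqrt (2 / 3) ∧
              (∀ w ∈ fccSlots, ⟪A₁ w, n⟫_ℝ ≤ 0 → e + A₁ w ∈ X) ∧
              (∀ w ∈ fccSlots, 0 < ⟪A₁ w, n⟫_ℝ → e + A₁ w ∉ X ∧ e - A₁ w + (2 * ⟪A₁ w, n⟫_ℝ) • n ∈ X)).card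
              : ℕ) : ℝ) +
           ((((X.filter fun e => e ∈ (fun q => A₂ q + t₂) '' fccStacking 1 (Real.sqrt (2 / 3)) ∧
                e - A₂ u₂ ∈ X ∧ (∀ w ∈ fccSlots, e - A₂ u₂ + A₂ w ∈ X) ∧
                ∃ v ∈ fccSlots, e + A₂ v ∉ X).filter fun e => ∃ n : EuclideanSpace ℝ (Fin 3), ‖n‖ = 1 ∧
              (∀ w ∈ fccSlots, ⟪A₂ w, n⟫_ℝ = 0 ∨ ⟪A₂ w, n⟫_ℝ = Real.sqrt (2 / 3) ∨
                ⟪A₂ w, n⟫_ℝ = -Real.sqrt (2 / 3)) ∧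
              ⟪A₂ u₂, n⟫_ℝ = Real.sqrt (2 / 3) ∧
              (∀ w ∈ fccSlots, ⟪A₂ w, n⟫_ℝ ≤ 0 → e + A₂ w ∈ X) ∧
              (∀ w ∈ fccSlots, 0 < ⟪A₂ w, n⟫_ℝ → e + A₂ w ∉ X ∧ e - A₂ w + (2 * ⟪A₂ w, n⟫_ℝ) • n ∈ X)).card
              : ℕ) : ℝ) +
           (((X.filter fun e => e ∈ (fun q => A₁ q + t₁) '' fccStacking 1 (Real.sqrt (2 / 3)) ∧
                e ∈ (fun q => A₂ q + t₂) '' fccStacking 1 (Real.sqrt (2 / 3)) ∧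
                (X.filter fun q => dist e q = 1).card ≠ 12 ∧
                (e - A₁ u₁ ∈ X ∧ (∀ w ∈ fccSlots, e - A₁ u₁ + A₁ w ∈ X) ∧ ∃ v ∈ fccSlots, e + A₁ v ∉ X) ∧
                (e - A₂ u₂ ∈ X ∧ (∀ w ∈ fccSlots, e - A₂ u₂ + A₂ w ∈ X) ∧ ∃ v ∈ fccSlots, e + A₂ v ∉ X)).card
              : ℕ) : ℝ)) / 2 +
          C * (1 + h) * ρ := by
  obtain ⟨C₁, hC₁⟩ := affineSampleDeficit_upper A₁ t₁ 10 (by norm_num)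
  obtain ⟨C₂, hC₂⟩ := affineSampleDeficit_upper A₂ t₂ 10 (by norm_num)
  refine ⟨(240 * Real.sqrt 2 * Real.pi + 3120 * (4 * 10 + 2)) / 2 + 100 + |C₁| + |C₂|, 10, by norm_num, ?_⟩
  intro h hh ρ hρ X P₁ P₂ hX hP₁X hP₂X hcell hP₁ hP₂ hclean₁ hclean₂
  set e₃ : EuclideanSpace ℝ (Fin 3) := EuclideanSpace.single (2 : Fin 3) (1 : ℝ) with he₃
  set φ₁ : ℝ := Real.sqrt 2 / 4 * ∑ᶠ w ∈ {w ∈ fccStacking 1 (Real.sqrt (2 / 3)) | ‖w‖ = 1},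
      |⟪w, A₁.symm e₃⟫_ℝ| with hφ₁
  set φ₂ : ℝ := Real.sqrt 2 / 4 * ∑ᶠ w ∈ {w ∈ fccStacking 1 (Real.sqrt (2 / 3)) | ‖w‖ = 1},
      |⟪w, A₂.symm e₃⟫_ℝ| with hφ₂
  set Λ₁ : Set (EuclideanSpace ℝ (Fin 3)) := (fun q => A₁ q + t₁) '' fccStacking 1 (Real.sqrt (2 / 3)) with hΛ₁
  set Λ₂ : Set (EuclideanSpace ℝ (Fin 3)) := (fun q => A₂ q + t₂) '' fccStacking 1 (Real.sqrt (2 / 3)) with hΛ₂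
  have hP₂X' : P₂ ⊆ X := hP₂X.trans Finset.sdiff_subset
  have hρ0 : (0 : ℝ) ≤ ρ := by linarith
  -- the exit predicates and the sets of the statement
  set EX₁ : EuclideanSpace ℝ (Fin 3) → Prop := fun e =>
    e - A₁ u₁ ∈ X ∧ (∀ w ∈ fccSlots, e - A₁ u₁ + A₁ w ∈ X) ∧ ∃ v ∈ fccSlots, e + A₁ v ∉ X with hEX₁
  set EX₂ : EuclideanSpace ℝ (Fin 3) → Prop := fun e =>
    e - A₂ u₂ ∈ X ∧ (∀ w ∈ fccSlots, e - A₂ u₂ + A₂ w ∈ X) ∧ ∃ v ∈ fccSlots, e + A₂ v ∉ X with hEX₂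
  set TW₁ : EuclideanSpace ℝ (Fin 3) → Prop := fun e => ∃ n : EuclideanSpace ℝ (Fin 3), ‖n‖ = 1 ∧
    (∀ w ∈ fccSlots, ⟪A₁ w, n⟫_ℝ = 0 ∨ ⟪A₁ w, n⟫_ℝ = Real.sqrt (2 / 3) ∨ ⟪A₁ w, n⟫_ℝ = -Real.sqrt (2 / 3)) ∧
    ⟪A₁ u₁, n⟫_ℝ = Real.sqrt (2 / 3) ∧ (∀ w ∈ fccSlots, ⟪A₁ w, n⟫_ℝ ≤ 0 → e + A₁ w ∈ X) ∧
    (∀ w ∈ fccSlots, 0 < ⟪A₁ w, n⟫_ℝ → e + A₁ w ∉ X ∧ e - A₁ w + (2 * ⟪A₁ w, n⟫_ℝ) • n ∈ X) with hTW₁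
  set TW₂ : EuclideanSpace ℝ (Fin 3) → Prop := fun e => ∃ n : EuclideanSpace ℝ (Fin 3), ‖n‖ = 1 ∧
    (∀ w ∈ fccSlots, ⟪A₂ w, n⟫_ℝ = 0 ∨ ⟪A₂ w, n⟫_ℝ = Real.sqrt (2 / 3) ∨ ⟪A₂ w, n⟫_ℝ = -Real.sqrt (2 / 3)) ∧
    ⟪A₂ u₂, n⟫_ℝ = Real.sqrt (2 / 3) ∧ (∀ w ∈ fccSlots, ⟪A₂ w, n⟫_ℝ ≤ 0 → e + A₂ w ∈ X) ∧
    (∀ w ∈ fccSlots, 0 < ⟪A₂ w, n⟫_ℝ → e + A₂ w ∉ X ∧ e - A₂ w + (2 * ⟪A₂ w, n⟫_ℝ) • n ∈ X) with hTW₂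
  set deg : EuclideanSpace ℝ (Fin 3) → ℕ := fun x => (X.filter fun q => dist x q = 1).card with hdeg
  set LEX₁ := X.filter fun e => e ∈ Λ₁ ∧ EX₁ e with hLEX₁
  set LEX₂ := X.filter fun e => e ∈ Λ₂ ∧ EX₂ e with hLEX₂
  set TC₁ := LEX₁.filter fun e => TW₁ e with hTC₁
  set TC₂ := LEX₂.filter fun e => TW₂ e with hTC₂
  set DT := X.filter fun e => e ∈ Λ₁ ∧ e ∈ Λ₂ ∧ deg e ≠ 12 ∧ EX₁ e ∧ EX₂ e with hDT
  set U₁ := LEX₁.filter fun e => deg e ≠ 12 with hU₁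
  set U₂ := LEX₂.filter fun e => deg e ≠ 12 with hU₂
  -- the ledger with payers
  have hled := ledger_ge_faces_add_payers A₁ t₁ A₂ t₂ X P₁ P₂ 10 h ρ le_rfl hh hρ hX hcell hP₁X hP₂X' hP₁ hP₂
    hclean₁ hclean₂ hA₁₂ hA₂₁ hu₁ hsteep₁ hu₂ hsteep₂
  rw [← finsum_unit_fcc_symm_eq_sum_slots A₁, ← finsum_unit_fcc_symm_eq_sum_slots A₂, ← hφ₁, ← hφ₂] at hled
  set PAY := X.filter fun y => (X.filter fun q => dist y q = 1).card ≠ 12 ∧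
    ((∃ e ∈ X, (e - A₁ u₁ ∈ X ∧ (∀ w ∈ fccSlots, e - A₁ u₁ + A₁ w ∈ X) ∧ ∃ v ∈ fccSlots, e + A₁ v ∉ X) ∧
        (y = e ∨ dist e y = 1 ∨ (∃ z ∈ X, dist e z = 1 ∧ dist z y = 1) ∨
          ∃ z ∈ X, ∃ z' ∈ X, dist e z = 1 ∧ dist z z' = 1 ∧ dist z' y = 1)) ∨
      (∃ e ∈ X, (e - A₂ u₂ ∈ X ∧ (∀ w ∈ fccSlots, e - A₂ u₂ + A₂ w ∈ X) ∧ ∃ v ∈ fccSlots, e + A₂ v ∉ X) ∧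
        (y = e ∨ dist e y = 1 ∨ (∃ z ∈ X, dist e z = 1 ∧ dist z y = 1) ∨
          ∃ z ∈ X, ∃ z' ∈ X, dist e z = 1 ∧ dist z z' = 1 ∧ dist z' y = 1))) with hPAY
  -- unsaturated lattice exits are payers
  have hU₁P : U₁ ⊆ PAY := by
    intro y hy
    rw [hU₁, mem_filter, hLEX₁, mem_filter] at hy
    obtain ⟨⟨hyX, -, hyE⟩, hyd⟩ := hy
    rw [hPAY, mem_filter]
    exact ⟨hyX, hyd, Or.inl ⟨y, hyX, hyE, Or.inl rfl⟩⟩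
  have hU₂P : U₂ ⊆ PAY := by
    intro y hy
    rw [hU₂, mem_filter, hLEX₂, mem_filter] at hy
    obtain ⟨⟨hyX, -, hyE⟩, hyd⟩ := hy
    rw [hPAY, mem_filter]
    exact ⟨hyX, hyd, Or.inr ⟨y, hyX, hyE, Or.inl rfl⟩⟩
  have hUU : U₁ ∩ U₂ ⊆ DT := by
    intro y hy
    have hy₁ : y ∈ U₁ := (mem_inter.1 hy).1
    have hy₂ : y ∈ U₂ := (mem_inter.1 hy).2
    rw [hU₁, mem_filter, hLEX₁, mem_filter] at hy₁
    rw [hU₂, mem_filter, hLEX₂, mem_filter] at hy₂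
    obtain ⟨⟨hyX, hyΛ₁, hyE₁⟩, hyd⟩ := hy₁
    obtain ⟨⟨-, hyΛ₂, hyE₂⟩, -⟩ := hy₂
    rw [hDT, mem_filter]
    exact ⟨hyX, hyΛ₁, hyΛ₂, hyd, hyE₁, hyE₂⟩
  have hPAYge : (U₁.card : ℝ) + U₂.card - DT.card ≤ PAY.card := by
    have h1 : (U₁ ∪ U₂).card ≤ PAY.card := card_le_card (union_subset hU₁P hU₂P)
    have h2 : (U₁ ∪ U₂).card + (U₁ ∩ U₂).card = U₁.card + U₂.card := card_union_add_card_inter U₁ U₂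
    have h3 : (U₁ ∩ U₂).card ≤ DT.card := card_le_card hUU
    have h4 : U₁.card + U₂.card ≤ PAY.card + DT.card := by omega
    have h5 := (Nat.cast_le (α := ℝ)).2 h4
    push_cast at h5
    linarith
  -- every lattice exit is unsaturated or twin-capped
  have hLEX₁le : LEX₁.card ≤ U₁.card + TC₁.card := by
    refine (card_le_card ?_).trans (card_union_le U₁ TC₁)
    intro e he
    have he' := he
    rw [hLEX₁, mem_filter] at he'
    obtain ⟨heX, -, hd, hfull, hv⟩ := he'
    rcases exit_unsaturated_or_twinCap hX hs₀ hcert A₁ hu₁ hd hfull hv with h11 | htw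
    · exact mem_union_left _ (mem_filter.2 ⟨he, by
        change (X.filter fun q => dist e q = 1).card ≠ 12; omega⟩)
    · exact mem_union_right _ (mem_filter.2 ⟨he, htw⟩)
  have hLEX₂le : LEX₂.card ≤ U₂.card + TC₂.card := by
    refine (card_le_card ?_).trans (card_union_le U₂ TC₂)
    intro e he
    have he' := he
    rw [hLEX₂, mem_filter] at he'
    obtain ⟨heX, -, hd, hfull, hv⟩ := he'
    rcases exit_unsaturated_or_twinCap hX hs₀ hcert A₂ hu₂ hd hfull hv with h11 | htw
    · exact mem_union_left _ (mem_filter.2 ⟨he, by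
        change (X.filter fun q => dist e q = 1).card ≠ 12; omega⟩)
    · exact mem_union_right _ (mem_filter.2 ⟨he, htw⟩)
  -- sources: lattice exits are at least a flux (19481-p2's lattice form of `card_exits_ge_window`)
  have hP₁w : ∀ p, p ∈ P₁ ↔ (p ∈ (fun q => A₁ q + t₁) '' fccStacking 1 (Real.sqrt (2 / 3)) ∧
      (-(2 * 10)) ≤ p 2 ∧ p 2 ≤ (-(2 * 10)) + 10 ∧ p 0 ^ 2 + p 1 ^ 2 ≤ ρ ^ 2) := by
    intro p; rw [hP₁ p, show -(2 * 10) + (10 : ℝ) = -10 by ring]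
  have hEX₁ := card_lattice_exits_ge_window A₁ t₁ X P₁ (-(2 * 10)) 10 ρ (by norm_num) hρ hP₁X hP₁w hu₁
  have hP₂w : ∀ p, p ∈ P₂ ↔ (p ∈ (fun q => A₂ q + t₂) '' fccStacking 1 (Real.sqrt (2 / 3)) ∧
      (h + 10) ≤ p 2 ∧ p 2 ≤ (h + 10) + 10 ∧ p 0 ^ 2 + p 1 ^ 2 ≤ ρ ^ 2) := by
    intro p; rw [hP₂ p, show h + 10 + 10 = h + 2 * 10 by ring]
  have hEX₂ := card_lattice_exits_ge_window A₂ t₂ X P₂ (h + 10) 10 ρ (by norm_num) hρ hP₂X' hP₂w hu₂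
  have hEX₁' : Real.sqrt 2 * |⟪A₁ u₁, e₃⟫_ℝ| * Real.pi * (ρ - 1) ^ 2 - 10 * Real.sqrt 2 * Real.pi * (ρ - 1) ≤
      (LEX₁.card : ℝ) := by convert hEX₁ using 3
  have hEX₂' : Real.sqrt 2 * |⟪A₂ u₂, e₃⟫_ℝ| * Real.pi * (ρ - 1) ^ 2 - 10 * Real.sqrt 2 * Real.pi * (ρ - 1) ≤
      (LEX₂.card : ℝ) := by convert hEX₂ using 3
  have hL₁ : (LEX₁.card : ℝ) ≤ U₁.card + TC₁.card := by exact_mod_cast hLEX₁le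
  have hL₂ : (LEX₂.card : ℝ) ≤ U₂.card + TC₂.card := by exact_mod_cast hLEX₂le
  -- fluxes `κᵢ ∈ [0, √2]`
  set κ₁ : ℝ := Real.sqrt 2 * |⟪A₁ u₁, e₃⟫_ℝ| with hκ₁
  set κ₂ : ℝ := Real.sqrt 2 * |⟪A₂ u₂, e₃⟫_ℝ| with hκ₂
  have hsq : 0 ≤ Real.sqrt 2 := Real.sqrt_nonneg 2
  have hs2' : Real.sqrt 2 ≤ 2 := by
    rw [show (2 : ℝ) = Real.sqrt (2 ^ 2) by rw [Real.sqrt_sq (by norm_num)]]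
    exact Real.sqrt_le_sqrt (by norm_num)
  have hκ₁0 : 0 ≤ κ₁ := mul_nonneg hsq (abs_nonneg _)
  have hκ₂0 : 0 ≤ κ₂ := mul_nonneg hsq (abs_nonneg _)
  have hκ₁2 : κ₁ ≤ 2 := by
    have := abs_inner_slot_le_one A₁ hu₁
    calc κ₁ = Real.sqrt 2 * |⟪A₁ u₁, e₃⟫_ℝ| := rfl
      _ ≤ 2 * 1 := mul_le_mul hs2' this (abs_nonneg _) (by norm_num)
      _ = 2 := by ring
  have hκ₂2 : κ₂ ≤ 2 := by
    have := abs_inner_slot_le_one A₂ hu₂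
    calc κ₂ = Real.sqrt 2 * |⟪A₂ u₂, e₃⟫_ℝ| := rfl
      _ ≤ 2 * 1 := mul_le_mul hs2' this (abs_nonneg _) (by norm_num)
      _ = 2 := by ring
  -- the two upper slab counts and the two splits
  have hD₁ := hC₁ (-(2 * 10)) (-10) (by ring) ρ hρ P₁ hP₁
  have hD₂ := hC₂ (h + 10) (h + 2 * 10) (by ring) ρ hρ P₂ hP₂
  have hsplit₁ := contactDeficiency_sdiff_split hP₁X
  have hsplit₂ := contactDeficiency_sdiff_split hP₂X
  have htwo := two_mul_contactDeficiency_eq_sum X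
  -- constants
  have hb : C₁ * ρ ≤ |C₁| * (1 + h) * ρ := by
    have h1 : 0 ≤ (|C₁| - C₁) * ρ := mul_nonneg (by linarith only [le_abs_self C₁]) hρ0
    have h2 : 0 ≤ |C₁| * h * ρ := by positivity
    linarith only [h1, h2]
  have hc' : C₂ * ρ ≤ |C₂| * (1 + h) * ρ := by
    have h1 : 0 ≤ (|C₂| - C₂) * ρ := mul_nonneg (by linarith only [le_abs_self C₂]) hρ0
    have h2 : 0 ≤ |C₂| * h * ρ := by positivity
    linarith only [h1, h2]
  have hπ : Real.pi ≤ 4 := Real.pi_le_four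
  have hπ0 : 0 ≤ Real.pi := Real.pi_pos.le
  -- `κ π (ρ−1)² − 10√2 π (ρ−1) ≥ κ π ρ² − 100 (1+h) ρ` for `κ ∈ [0, 2]`
  have hkey : ∀ κ : ℝ, 0 ≤ κ → κ ≤ 2 →
      κ * Real.pi * ρ ^ 2 - 100 * (1 + h) * ρ ≤ κ * Real.pi * (ρ - 1) ^ 2 - 10 * Real.sqrt 2 * Real.pi * (ρ - 1) := by
    intro κ hκ0 hκ2
    have e : κ * Real.pi * (ρ - 1) ^ 2 - 10 * Real.sqrt 2 * Real.pi * (ρ - 1) - (κ * Real.pi * ρ ^ 2 - 100 * (1 + h) * ρ)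
        = (100 * ρ - 2 * (κ * Real.pi * ρ) - 10 * (Real.sqrt 2 * Real.pi * ρ)) + 100 * (h * ρ) + κ * Real.pi +
          10 * (Real.sqrt 2 * Real.pi) := by ring
    have h1 : 0 ≤ h * ρ := mul_nonneg hh hρ0
    have h2 : 0 ≤ Real.sqrt 2 * Real.pi := mul_nonneg hsq hπ0
    have h3 : κ * Real.pi * ρ ≤ 8 * ρ := by
      have : κ * Real.pi ≤ 2 * 4 := mul_le_mul hκ2 hπ hπ0 (by norm_num)
      exact (mul_le_mul_of_nonneg_right this hρ0).trans (by linarith)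
    have h4 : Real.sqrt 2 * Real.pi * ρ ≤ 8 * ρ := by
      have : Real.sqrt 2 * Real.pi ≤ 8 := by nlinarith only [hπ, hπ0, hsq, hs2']
      exact mul_le_mul_of_nonneg_right this hρ0
    have h5 : 0 ≤ κ * Real.pi := mul_nonneg hκ0 hπ0
    linarith only [e, h1, h2, h3, h4, h5, hρ0]
  have hkey₁ := hkey κ₁ hκ₁0 hκ₁2
  have hkey₂ := hkey κ₂ hκ₂0 hκ₂2
  have hhρ : 0 ≤ h * ρ := mul_nonneg hh hρ0
  linarith only [hled, hEX₁', hEX₂', hPAYge, hL₁, hL₂, hD₁, hD₂, hsplit₁, hsplit₂, htwo, hb, hc', hkey₁, hkey₂,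
    hρ0, hh, hhρ, hπ0]

end Summit.Ventures.Crystal3D.Theorems

end
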